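import Literature.MathematicalPhysics.QuantumFieldTheory.BalabanImbrieJaffe1984to88.BIJ88Eq5612W6

/-!
# `BalabanImbrieJaffe1984to88.BIJ88W6PrimeSmall287` — T. Bałaban, J. Imbrie, A. Jaffe, *Effective action and cluster properties of
the abelian Higgs model*, Commun. Math. Phys. **114** (1988) 257–315 [BalabanImbrieJaffe1988], Sect. 5.6 p. 287 [PDF 31], the sentence
between the two displays at the foot of the page, verbatim: *"The second term can be changed slightly by changing the set □_α in G_j
and changing the tails of the operators. The difference is w′₆, a small (O(e^{−cr(e_j)})), local kernel with small covariant
derivatives, and depending only locally on ũ_{k+1}, ũ."* — the SIZE `O(e^{−cr(e_j)})` and the LOCALITY of `w′₆` PROVED, at operator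
level (complex kernels on a finite site set, max-row-sum operator norm), for the `w′₆ = BIJ88Eq5612W6.w6prime` of record, from the
printed inputs of Sect. 2 in kernel form: the decay **(2.30)** of the propagators, the localization **(2.31)** of `G_j(□_α,·)` inside
`□_α`, the cutoff **(2.29)** `ζ″_j`, the convex combination **(2.27)** `Σ_α λ_α = 1`, and the structure of `V_j` from (5.6.10).

statement-level skeleton of published theorems with citation tags; proofs where landed; nothing here is a claim about the Yang–Mills mass gap

PDF held: `paper:balaban1988-cmp114-bij-abelian-higgs-effective-action` (journal page = PDF page + 256); p. 287 = PDF p. 31 re-read this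
session as an image (x2 render), pp. 260–263 [PDF 4–7] through r18's reviewed transcription `BIJ88Sect2Statements` ((2.27)–(2.31)).

THE MECHANISM, as printed, in two moves.  Write `T := ζ″Σ_αλ_α(G_αV_αG′_α)` (the second term of the first display; `G_α = G_j(□_α,
ũ_{k+1})`, `G′_α = G_j(□_α,ũ_{k+1}ũ)`, `V_α = V_j(□_α)`) and `S := G_{loc}V_jG′_{loc}` (its changed form), so that `w′₆ = T − S`
(`BIJ88Eq5612W6.w6prime`, by definition).  *"changing the set □_α in G_j"*: inside the core of `□_α` — where `λ_α ≠ 0` and at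
distance `≤ R₂` from there — `G_α`, `G′_α` differ from reference propagators `G_ref`, `G′_ref` (e.g. `G_{j,loc}` itself, by (2.31) with
`Ω = □_α`, §4) by `δe^{−c d}` (`δ = e^{−cr(e_j)}`), and `V_α = V_j` there (Neumann conditions act at `∂□_α` only, §5); outside the
core the decay (2.30) of the row `G(x₁,·)` over the distance `> R₂` pays `e^{−(c/2)(R₂−ρ)}` (`ρ` = the range of `V_j`); since
`Σ_αλ_α = 1` exactly, replacing every `G_α` by `G_ref` costs only these differences (§3).  *"changing the tails of the operators"*:
`ζ″(x₁,x₂)G_refV_jG′_ref(x₁,x₂)` versus `(ζ″G_ref)V_j(ζ″G′_ref)(x₁,x₂)` differ only through `ζ″(x₁,x₂) − ζ″(x₁,y)ζ″(z,x₂)`, which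
vanishes unless one of the three distances exceeds the inner threshold `R₁` of (2.29), and then the decay pays `e^{−(c/2)(R₁−ρ)}`
(§2).  RESULT (§4, `norm_w6prime_le`): `‖w′₆‖ ≤ CK²v·[Λ₀(Λ₀+3)δ + 4Λ₀Ce^{−(c/2)(R₂−ρ)} + 2Ce^{−(c/2)(R₁−ρ)}]` — every term carries a
factor `e^{−c′r(e_j)}` once `δ = e^{−cr(e_j)}`, `R₁ = r(e_{j−1})/(8L)` ((2.29)) and `R₂ = O(r(e_j))` ((2.27), the cubes): the printed
`O(e^{−cr(e_j)})`; with `BIJ88Eq5612W6.norm_w6_matrix_le` the kernel `w₆` of (5.6.12) inherits the bound (`norm_w6_le_printed`).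
LOCALITY (§1, `w6prime_apply_eq_zero`): `w′₆(x₁,x₂) = 0` for `d(x₁,x₂) ≥ 2R₀ + ρ` (`R₀` the outer threshold of ζ″).

HONEST SCOPE.  (a) The inputs are the printed (2.30)/(2.31) in KERNEL form (`f = δ_y` in the printed operator form) with explicit
constants `C, c, δ`, the threshold form of (2.29), `Σ_αλ_α = 1` of (2.27) with a local multiplicity bound `Σ_α sup|ζ″λ_α| ≤ Λ₀` (each
point lies in the cores of boundedly many cubes), the lattice constant `Σ_y e^{−(c/2)d(x,y)} ≤ K`, and for `V_j`: finite range `ρ`,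
row sums `≤ v` (the size `O(e_j^{1−α})` is `BIJ88VjSmall287`) and `V_j(□_α)(y,·) = V_j(y,·)` in the core (§5 proves this for the
computed `BIJ88Vj5610Operator.vjMat`: its `Ω`-dependence at row `y` is through the bonds at `y` only); they are hypotheses here, on
their own rows of the cell's skeleton.  (b) *"with small covariant derivatives"* and *"depending only locally on ũ_{k+1}, ũ"* are not
treated (the first is the same argument for the family `D G_α` plus the derivative of ζ″; the second is a statement about the
field dependence, not about the kernel).  (c) The distance `d` is any function with `d(x,x) = 0`, `d ≥ 0` and the triangle
inequality (the torus distance of record).  Unit `lit-balaban-p31` (literature-prover-lit-balaban-p31-g10-0), 2026-08-22.  NOT summit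
progress.
-/

namespace Literature.MathematicalPhysics.QuantumFieldTheory.BalabanImbrieJaffe1984to88.BIJ88W6PrimeSmall287

open Literature.MathematicalPhysics.QuantumFieldTheory.Balaban1983to89
open BIJ88Sect3Statements (starB)
open BIJ88Vj5610Operator (dMat mMat qMat f2Mat chiN vjMat)
open BIJ88Eq5612W6 (gLoc gLoc_apply w6 w6prime norm_w6_matrix_le)
open scoped BigOperators Matrix Matrix.Norms.Operator NNReal
open Matrix Finset

noncomputable section

/-! ## §0 Tools: rows of the max-row-sum norm; exponential bookkeeping -/

section Tools

variable {m n p : Type*} [Fintype n] [Fintype p]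

/-- kernel: one row sum is at most the `ℓ^∞`-operator norm (Mathlib `Matrix.linfty_opNorm_def`). [folklore] -/
private theorem rowSum_le_norm [Fintype m] (B : Matrix m n ℂ) (k : m) : ∑ j, ‖B k j‖ ≤ ‖B‖ := by
  rw [Matrix.linfty_opNorm_def]
  have h : (∑ j, ‖B k j‖₊) ≤ Finset.univ.sup fun i : m => ∑ j : n, ‖B i j‖₊ :=
    Finset.le_sup (f := fun i : m => ∑ j : n, ‖B i j‖₊) (Finset.mem_univ k)
  have h' := NNReal.coe_le_coe.mpr h
  push_cast at h'
  exact h'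

/-- kernel: uniform row-sum bounds bound the norm. [folklore] -/
private theorem norm_le_of_rowSums [Fintype m] (A : Matrix m n ℂ) {r : ℝ} (hr : 0 ≤ r) (h : ∀ i, ∑ j, ‖A i j‖ ≤ r) : ‖A‖ ≤ r := by
  rw [Matrix.linfty_opNorm_def]
  have key : (Finset.univ.sup fun i : m => ∑ j : n, ‖A i j‖₊) ≤ Real.toNNReal r := by
    refine Finset.sup_le fun i _ => ?_
    rw [← NNReal.coe_le_coe, Real.coe_toNNReal r hr]
    push_cast
    exact h i
  calc ((Finset.univ.sup fun i : m => ∑ j : n, ‖A i j‖₊ : ℝ≥0) : ℝ) ≤ (Real.toNNReal r : ℝ) := NNReal.coe_le_coe.mpr key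
    _ = r := Real.coe_toNNReal r hr

/-- kernel: a row of a product, explicitly. [folklore] -/
private theorem rowSum_mul_le' (A : Matrix m n ℂ) (B : Matrix n p ℂ) (i : m) :
    ∑ j, ‖(A * B) i j‖ ≤ ∑ k, ‖A i k‖ * ∑ j, ‖B k j‖ := by
  calc ∑ j, ‖(A * B) i j‖ ≤ ∑ j, ∑ k, ‖A i k‖ * ‖B k j‖ := by
        refine Finset.sum_le_sum fun j _ => ?_
        rw [Matrix.mul_apply]
        exact (norm_sum_le _ _).trans (Finset.sum_le_sum fun k _ => norm_mul_le _ _)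
    _ = ∑ k, ‖A i k‖ * ∑ j, ‖B k j‖ := by
        rw [Finset.sum_comm]
        simp_rw [Finset.mul_sum]

/-- kernel: a row of a product is at most the row of the first factor times the norm of the second. [folklore] -/
private theorem rowSum_mul_le (A : Matrix m n ℂ) (B : Matrix n p ℂ) (i : m) :
    ∑ j, ‖(A * B) i j‖ ≤ (∑ k, ‖A i k‖) * ‖B‖ := by
  calc ∑ j, ‖(A * B) i j‖ ≤ ∑ k, ‖A i k‖ * ∑ j, ‖B k j‖ := rowSum_mul_le' A B i
    _ ≤ ∑ k, ‖A i k‖ * ‖B‖ :=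
        Finset.sum_le_sum fun k _ => mul_le_mul_of_nonneg_left (rowSum_le_norm B k) (norm_nonneg _)
    _ = (∑ k, ‖A i k‖) * ‖B‖ := by rw [Finset.sum_mul]

/-- kernel: `e^{−ct} ≤ e^{−(c/2)t}` for `c, t ≥ 0`. [folklore] -/
private theorem exp_half_le {c t : ℝ} (hc : 0 ≤ c) (ht : 0 ≤ t) : Real.exp (-c * t) ≤ Real.exp (-(c / 2) * t) :=
  Real.exp_le_exp.mpr (by nlinarith)

/-- kernel: `e^{−ct} ≤ e^{−(c/2)R}e^{−(c/2)t}` for `c ≥ 0`, `t ≥ R` — half the decay pays the threshold. [folklore] -/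
private theorem exp_split_le {c t R : ℝ} (hc : 0 ≤ c) (hR : R ≤ t) :
    Real.exp (-c * t) ≤ Real.exp (-(c / 2) * R) * Real.exp (-(c / 2) * t) := by
  rw [← Real.exp_add]
  exact Real.exp_le_exp.mpr (by nlinarith)

/-- kernel: `e^{−(c/2)R} ≤ e^{−(c/2)(R−ρ)}` for `c, ρ ≥ 0`. [folklore] -/
private theorem exp_mono_R {c R ρ : ℝ} (hc : 0 ≤ c) (hρ : 0 ≤ ρ) :
    Real.exp (-(c / 2) * R) ≤ Real.exp (-(c / 2) * (R - ρ)) :=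
  Real.exp_le_exp.mpr (by nlinarith)

end Tools

/-! ## §0′ Decaying kernels have bounded rows -/

section Decay

variable {σ : Type*} [Fintype σ]

/-- kernel: `Σ_ye^{−c d(x,y)} ≤ Σ_ye^{−(c/2)d(x,y)} ≤ K`. [folklore] -/
private theorem sum_exp_le {d : σ → σ → ℝ} {c K : ℝ} (hc : 0 ≤ c) (hd : ∀ x y, 0 ≤ d x y)
    (hK : ∀ x, ∑ y, Real.exp (-(c / 2) * d x y) ≤ K) (x : σ) : ∑ y, Real.exp (-c * d x y) ≤ K :=
  (Finset.sum_le_sum fun y _ => exp_half_le hc (hd x y)).trans (hK x)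

/-- kernel: `‖G(x,y)‖ ≤ Ce^{−c d(x,y)}` gives rows `≤ CK`. [folklore] -/
private theorem rowSum_le_of_decay {d : σ → σ → ℝ} {c C K : ℝ} (hc : 0 ≤ c) (hd : ∀ x y, 0 ≤ d x y)
    (hK : ∀ x, ∑ y, Real.exp (-(c / 2) * d x y) ≤ K) {G : Matrix σ σ ℂ}
    (hG : ∀ x y, ‖G x y‖ ≤ C * Real.exp (-c * d x y)) (x : σ) : ∑ y, ‖G x y‖ ≤ C * K := by
  rcases isEmpty_or_nonempty σ with hσ | hσ
  · exact (isEmptyElim x)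
  have hC : 0 ≤ C := by
    have h := hG x x
    have hpos : 0 < Real.exp (-c * d x x) := Real.exp_pos _
    nlinarith [norm_nonneg (G x x)]
  calc ∑ y, ‖G x y‖ ≤ ∑ y, C * Real.exp (-c * d x y) := Finset.sum_le_sum fun y _ => hG x y
    _ = C * ∑ y, Real.exp (-c * d x y) := by rw [Finset.mul_sum]
    _ ≤ C * K := by gcongr; exact sum_exp_le hc hd hK x

/-- kernel: and norm `≤ CK`. [folklore] -/
private theorem norm_le_of_decay {d : σ → σ → ℝ} {c C K : ℝ} (hc : 0 ≤ c) (hC : 0 ≤ C) (hK₀ : 0 ≤ K)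
    (hd : ∀ x y, 0 ≤ d x y) (hK : ∀ x, ∑ y, Real.exp (-(c / 2) * d x y) ≤ K) {G : Matrix σ σ ℂ}
    (hG : ∀ x y, ‖G x y‖ ≤ C * Real.exp (-c * d x y)) : ‖G‖ ≤ C * K :=
  norm_le_of_rowSums G (mul_nonneg hC hK₀) (rowSum_le_of_decay hc hd hK hG)

end Decay

/-! ## §1 *"local kernel"*: `w′₆` has finite range `2R₀ + ρ` -/

section Local

variable {σ ι : Type*} [Fintype σ] [Fintype ι]

/-- **`w′₆` is a local kernel**: if `ζ″(x,y) = 0` for `d(x,y) ≥ R₀` ((2.29), outer threshold) and `V_j(y,z) = 0` for `d(y,z) > ρ`,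
then `w′₆(x₁,x₂) = 0` whenever `d(x₁,x₂) ≥ 2R₀ + ρ` — both terms of `w′₆ = ζ″Σ_αλ_α(G_αV_αG′_α) − G_{loc}V_jG′_{loc}` vanish there
(`G_{loc} = ζ″Σ_αλ_αG_α` has range `R₀`). [cite: BalabanImbrieJaffe1988, (5.6.12) p.287] -/
theorem w6prime_apply_eq_zero {d : σ → σ → ℝ} {R₀ ρ : ℝ} (hR₀ : 0 ≤ R₀) (hρ : 0 ≤ ρ)
    (htri : ∀ x y z, d x z ≤ d x y + d y z)
    {Z : σ → σ → ℂ} (hZ0 : ∀ x y, R₀ ≤ d x y → Z x y = 0) (Λ : ι → σ → σ → ℂ) (G V G' : ι → Matrix σ σ ℂ)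
    {Vj : Matrix σ σ ℂ} (hVρ : ∀ y z, Vj y z ≠ 0 → d y z ≤ ρ)
    {x₁ x₂ : σ} (hfar : 2 * R₀ + ρ ≤ d x₁ x₂) : w6prime Z Λ G V G' Vj x₁ x₂ = 0 := by
  have hZ12 : Z x₁ x₂ = 0 := hZ0 x₁ x₂ (by linarith)
  rw [w6prime, Matrix.sub_apply, Matrix.of_apply, hZ12, zero_mul, zero_sub, neg_eq_zero, Matrix.mul_apply]
  refine Finset.sum_eq_zero fun z _ => ?_
  by_cases hz : R₀ ≤ d z x₂
  · rw [gLoc_apply Z Λ G' z x₂, hZ0 z x₂ hz, zero_mul, mul_zero]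
  rw [Matrix.mul_apply]
  refine mul_eq_zero_of_left (Finset.sum_eq_zero fun y _ => ?_) _
  by_cases hy : R₀ ≤ d x₁ y
  · rw [gLoc_apply Z Λ G x₁ y, hZ0 x₁ y hy, zero_mul, zero_mul]
  by_cases hV : Vj y z = 0
  · rw [hV, mul_zero]
  exfalso
  have hyz := hVρ y z hV
  have h3 : d x₁ x₂ ≤ d x₁ y + d y z + d z x₂ := (htri x₁ z x₂).trans (by linarith [htri x₁ y z])
  push Not at hy hz
  linarith

end Local

/-! ## §2 *"changing the tails of the operators"* -/

section Tails

variable {σ : Type*} [Fintype σ]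

/-- **changing the tails**: with `ζ″ = 1` within `R₁` and `|ζ″| ≤ 1` ((2.29)), decaying reference propagators ((2.30):
`‖G_ref(x,y)‖, ‖G′_ref(x,y)‖ ≤ Ce^{−c d(x,y)}`), `V_j` of range `ρ` with rows `≤ v`, and `Σ_ye^{−(c/2)d(x,y)} ≤ K`: every row of
`ζ″(G_refV_jG′_ref) − (ζ″G_ref)V_j(ζ″G′_ref)` is at most `2C²K²v·e^{−(c/2)(R₁−ρ)}` — the bracket `ζ″(x₁,x₂) − ζ″(x₁,y)ζ″(z,x₂)`
vanishes unless `d(x₁,y) + d(z,x₂) ≥ R₁ − ρ`, where the decay pays. [cite: BalabanImbrieJaffe1988, (5.6.12) p.287] -/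
theorem rowSum_tails_le {d : σ → σ → ℝ} {c C K v R₁ ρ : ℝ} (hc : 0 ≤ c) (hC : 0 ≤ C) (hv : 0 ≤ v) (hρ : 0 ≤ ρ)
    (hd : ∀ x y, 0 ≤ d x y) (htri : ∀ x y z, d x z ≤ d x y + d y z)
    (hK : ∀ x, ∑ y, Real.exp (-(c / 2) * d x y) ≤ K)
    {Z : σ → σ → ℂ} (hZ1 : ∀ x y, ‖Z x y‖ ≤ 1) (hZR₁ : ∀ x y, d x y ≤ R₁ → Z x y = 1)
    {Gref Vj Gref' : Matrix σ σ ℂ}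
    (hGr : ∀ x y, ‖Gref x y‖ ≤ C * Real.exp (-c * d x y)) (hGr' : ∀ x y, ‖Gref' x y‖ ≤ C * Real.exp (-c * d x y))
    (hVj : ∀ y, ∑ z, ‖Vj y z‖ ≤ v) (hVρ : ∀ y z, Vj y z ≠ 0 → d y z ≤ ρ) (x₁ : σ) :
    ∑ x₂, ‖Z x₁ x₂ * (Gref * Vj * Gref') x₁ x₂
        - ((Matrix.of fun x y => Z x y * Gref x y) * Vj * Matrix.of fun x y => Z x y * Gref' x y) x₁ x₂‖
      ≤ 2 * C ^ 2 * K ^ 2 * v * Real.exp (-(c / 2) * (R₁ - ρ)) := by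
  set E := Real.exp (-(c / 2) * (R₁ - ρ)) with hE
  have hK₀ : 0 ≤ K := (Finset.sum_nonneg fun y _ => (Real.exp_pos _).le).trans (hK x₁)
  -- the entry as a double sum over the bracket
  have hentry : ∀ x₂, Z x₁ x₂ * (Gref * Vj * Gref') x₁ x₂
      - ((Matrix.of fun x y => Z x y * Gref x y) * Vj * Matrix.of fun x y => Z x y * Gref' x y) x₁ x₂
      = ∑ z, ∑ y, (Z x₁ x₂ - Z x₁ y * Z z x₂) * (Gref x₁ y * Vj y z * Gref' z x₂) := by
    intro x₂
    simp only [Matrix.mul_apply, Matrix.of_apply, Finset.mul_sum, Finset.sum_mul, ← Finset.sum_sub_distrib]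
    refine Finset.sum_congr rfl fun z _ => Finset.sum_congr rfl fun y _ => ?_
    ring
  -- the bracket estimate, term by term
  have hterm : ∀ y z x₂, ‖(Z x₁ x₂ - Z x₁ y * Z z x₂) * (Gref x₁ y * Vj y z * Gref' z x₂)‖
      ≤ 2 * C ^ 2 * E * (Real.exp (-(c / 2) * d x₁ y) * ‖Vj y z‖ * Real.exp (-(c / 2) * d z x₂)) := by
    intro y z x₂
    by_cases hV : Vj y z = 0
    · rw [hV]; simp
    have hyz : d y z ≤ ρ := hVρ y z hV
    by_cases hnear : d x₁ y ≤ R₁ ∧ d z x₂ ≤ R₁ ∧ d x₁ x₂ ≤ R₁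
    · rw [hZR₁ _ _ hnear.1, hZR₁ _ _ hnear.2.1, hZR₁ _ _ hnear.2.2]
      simp only [mul_one, sub_self, zero_mul, norm_zero]
      positivity
    have hsum : R₁ - ρ ≤ d x₁ y + d z x₂ := by
      by_cases h1 : d x₁ y ≤ R₁
      · by_cases h2 : d z x₂ ≤ R₁
        · have h3 : R₁ < d x₁ x₂ := lt_of_not_ge fun h => hnear ⟨h1, h2, h⟩
          have h4 : d x₁ x₂ ≤ d x₁ y + d y z + d z x₂ := (htri x₁ z x₂).trans (by linarith [htri x₁ y z])
          linarith
        · push Not at h2; linarith [hd x₁ y]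
      · push Not at h1; linarith [hd z x₂]
    have hbr : ‖Z x₁ x₂ - Z x₁ y * Z z x₂‖ ≤ 2 := by
      calc ‖Z x₁ x₂ - Z x₁ y * Z z x₂‖ ≤ ‖Z x₁ x₂‖ + ‖Z x₁ y * Z z x₂‖ := norm_sub_le _ _
        _ ≤ 1 + 1 * 1 := by rw [norm_mul]; gcongr <;> apply hZ1
        _ = 2 := by norm_num
    have hGG : ‖Gref x₁ y‖ * ‖Gref' z x₂‖
        ≤ C ^ 2 * E * (Real.exp (-(c / 2) * d x₁ y) * Real.exp (-(c / 2) * d z x₂)) := by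
      calc ‖Gref x₁ y‖ * ‖Gref' z x₂‖ ≤ (C * Real.exp (-c * d x₁ y)) * (C * Real.exp (-c * d z x₂)) :=
            mul_le_mul (hGr x₁ y) (hGr' z x₂) (norm_nonneg _) (by positivity)
        _ = C ^ 2 * Real.exp (-c * (d x₁ y + d z x₂)) := by rw [mul_add, Real.exp_add]; ring
        _ ≤ C ^ 2 * (Real.exp (-(c / 2) * (R₁ - ρ)) * Real.exp (-(c / 2) * (d x₁ y + d z x₂))) := by
            gcongr; exact exp_split_le hc hsum
        _ = C ^ 2 * E * (Real.exp (-(c / 2) * d x₁ y) * Real.exp (-(c / 2) * d z x₂)) := by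
            rw [hE, mul_add, Real.exp_add]; ring
    calc ‖(Z x₁ x₂ - Z x₁ y * Z z x₂) * (Gref x₁ y * Vj y z * Gref' z x₂)‖
        = ‖Z x₁ x₂ - Z x₁ y * Z z x₂‖ * (‖Gref x₁ y‖ * ‖Gref' z x₂‖ * ‖Vj y z‖) := by
          simp only [norm_mul]; ring
      _ ≤ 2 * (C ^ 2 * E * (Real.exp (-(c / 2) * d x₁ y) * Real.exp (-(c / 2) * d z x₂)) * ‖Vj y z‖) := by
          gcongr
      _ = _ := by ring
  -- summing
  calc ∑ x₂, ‖Z x₁ x₂ * (Gref * Vj * Gref') x₁ x₂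
          - ((Matrix.of fun x y => Z x y * Gref x y) * Vj * Matrix.of fun x y => Z x y * Gref' x y) x₁ x₂‖
      = ∑ x₂, ‖∑ z, ∑ y, (Z x₁ x₂ - Z x₁ y * Z z x₂) * (Gref x₁ y * Vj y z * Gref' z x₂)‖ := by
        simp_rw [hentry]
    _ ≤ ∑ x₂, ∑ z, ∑ y, 2 * C ^ 2 * E * (Real.exp (-(c / 2) * d x₁ y) * ‖Vj y z‖ * Real.exp (-(c / 2) * d z x₂)) :=
        Finset.sum_le_sum fun x₂ _ => (norm_sum_le _ _).trans (Finset.sum_le_sum fun z _ =>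
          (norm_sum_le _ _).trans (Finset.sum_le_sum fun y _ => hterm y z x₂))
    _ = ∑ y, ∑ z, ∑ x₂, 2 * C ^ 2 * E * (Real.exp (-(c / 2) * d x₁ y) * ‖Vj y z‖ * Real.exp (-(c / 2) * d z x₂)) := by
        rw [Finset.sum_comm]
        refine (Finset.sum_congr rfl fun z _ => Finset.sum_comm).trans ?_
        rw [Finset.sum_comm]
    _ = ∑ y, 2 * C ^ 2 * E * Real.exp (-(c / 2) * d x₁ y) * ∑ z, ‖Vj y z‖ * ∑ x₂, Real.exp (-(c / 2) * d z x₂) := by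
        refine Finset.sum_congr rfl fun y _ => ?_
        rw [Finset.mul_sum]
        refine Finset.sum_congr rfl fun z _ => ?_
        rw [Finset.mul_sum, Finset.mul_sum]
        refine Finset.sum_congr rfl fun x₂ _ => ?_
        ring
    _ ≤ ∑ y, 2 * C ^ 2 * E * Real.exp (-(c / 2) * d x₁ y) * ∑ z, ‖Vj y z‖ * K := by
        gcongr with y _ z _
        exact hK z
    _ = ∑ y, 2 * C ^ 2 * E * Real.exp (-(c / 2) * d x₁ y) * ((∑ z, ‖Vj y z‖) * K) := by
        simp_rw [Finset.sum_mul]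
    _ ≤ ∑ y, 2 * C ^ 2 * E * Real.exp (-(c / 2) * d x₁ y) * (v * K) := by
        gcongr with y _
        exact hVj y
    _ = 2 * C ^ 2 * E * (v * K) * ∑ y, Real.exp (-(c / 2) * d x₁ y) := by
        rw [Finset.mul_sum]; refine Finset.sum_congr rfl fun y _ => ?_; ring
    _ ≤ 2 * C ^ 2 * E * (v * K) * K := by gcongr; exact hK x₁
    _ = 2 * C ^ 2 * K ^ 2 * v * E := by ring

end Tails

/-! ## §3 *"changing the set □_α in G_j"* -/

section ChangeSet

variable {σ ι : Type*} [Fintype σ] [Fintype ι]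

/-- **changing the set, one cube**: for a row `x₁` all of whose `R₂`-neighbours lie in the core of `□_α` (where (2.31) holds:
`‖G_α(z,·) − G_ref(z,·)‖, ‖G′_α(z,·) − G′_ref(z,·)‖ ≤ δe^{−c d(z,·)}`, and where `V_α(z,·) = V_j(z,·)`), the row `x₁` of
`G_αV_αG′_α − G_refV_jG′_ref` is at most `CK²v(2δ + 4Ce^{−(c/2)(R₂−ρ)})`: the three replacements `G_α → G_ref` (at `x₁`, cost `δ`),
`V_α → V_j` (rows `y` outside the core are reached only over the distance `> R₂`), `G′_α → G′_ref` (rows `z` outside the core are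
reached only over `> R₂ − ρ`). [cite: BalabanImbrieJaffe1988, (5.6.11) p.287] -/
theorem rowSum_changeSet_le {d : σ → σ → ℝ} {Core : σ → Prop} {c C δ K v R₂ ρ : ℝ}
    (hc : 0 ≤ c) (hC : 0 ≤ C) (hδ : 0 ≤ δ) (hv : 0 ≤ v) (hρ : 0 ≤ ρ) (hR₂ : 0 ≤ R₂)
    (hd : ∀ x y, 0 ≤ d x y) (hdd : ∀ x, d x x = 0) (htri : ∀ x y z, d x z ≤ d x y + d y z)
    (hK : ∀ x, ∑ y, Real.exp (-(c / 2) * d x y) ≤ K)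
    {Gα Vα G'α Gref Vj Gref' : Matrix σ σ ℂ}
    (hG'α : ∀ x y, ‖G'α x y‖ ≤ C * Real.exp (-c * d x y)) (hGr : ∀ x y, ‖Gref x y‖ ≤ C * Real.exp (-c * d x y))
    (hGr' : ∀ x y, ‖Gref' x y‖ ≤ C * Real.exp (-c * d x y))
    (hLG : ∀ z y, Core z → ‖Gα z y - Gref z y‖ ≤ δ * Real.exp (-c * d z y))
    (hLG' : ∀ z y, Core z → ‖G'α z y - Gref' z y‖ ≤ δ * Real.exp (-c * d z y))
    (hVα : ∀ y, ∑ z, ‖Vα y z‖ ≤ v) (hVj : ∀ y, ∑ z, ‖Vj y z‖ ≤ v) (hVρ : ∀ y z, Vj y z ≠ 0 → d y z ≤ ρ)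
    (hVloc : ∀ y z, Core y → Vα y z = Vj y z)
    {x₁ : σ} (hx₁ : ∀ z, d x₁ z ≤ R₂ → Core z) :
    ∑ x₂, ‖(Gα * Vα * G'α - Gref * Vj * Gref') x₁ x₂‖
      ≤ C * K ^ 2 * v * (2 * δ + 4 * C * Real.exp (-(c / 2) * (R₂ - ρ))) := by
  set E := Real.exp (-(c / 2) * (R₂ - ρ)) with hE
  have hK₀ : 0 ≤ K := (Finset.sum_nonneg fun y _ => (Real.exp_pos _).le).trans (hK x₁)
  have hCore₁ : Core x₁ := hx₁ x₁ (by rw [hdd]; exact hR₂)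
  have hdec : Gα * Vα * G'α - Gref * Vj * Gref'
      = (Gα - Gref) * (Vα * G'α) + Gref * ((Vα - Vj) * G'α) + Gref * Vj * (G'α - Gref') := by
    simp only [Matrix.sub_mul, Matrix.mul_sub, Matrix.mul_assoc]
    abel
  -- (i) `G_α → G_ref` at the row `x₁`
  have h1 : ∑ x₂, ‖((Gα - Gref) * (Vα * G'α)) x₁ x₂‖ ≤ δ * K * (v * (C * K)) := by
    have hA : ∑ y, ‖(Gα - Gref) x₁ y‖ ≤ δ * K := by
      calc ∑ y, ‖(Gα - Gref) x₁ y‖ ≤ ∑ y, δ * Real.exp (-c * d x₁ y) :=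
            Finset.sum_le_sum fun y _ => by rw [Matrix.sub_apply]; exact hLG x₁ y hCore₁
        _ = δ * ∑ y, Real.exp (-c * d x₁ y) := by rw [Finset.mul_sum]
        _ ≤ δ * K := by gcongr; exact sum_exp_le hc hd hK x₁
    have hB : ‖Vα * G'α‖ ≤ v * (C * K) :=
      (norm_mul_le _ _).trans
        (mul_le_mul (norm_le_of_rowSums _ hv hVα) (norm_le_of_decay hc hC hK₀ hd hK hG'α) (norm_nonneg _) hv)
    exact (rowSum_mul_le _ _ _).trans (mul_le_mul hA hB (norm_nonneg _) (by positivity))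
  -- (ii) `V_α → V_j`: rows `y` in the core agree, rows outside are far from `x₁`
  have h2 : ∑ x₂, ‖(Gref * ((Vα - Vj) * G'α)) x₁ x₂‖ ≤ C * E * K * (2 * v * (C * K)) := by
    calc ∑ x₂, ‖(Gref * ((Vα - Vj) * G'α)) x₁ x₂‖
        ≤ ∑ y, ‖Gref x₁ y‖ * ∑ x₂, ‖((Vα - Vj) * G'α) y x₂‖ := rowSum_mul_le' _ _ _
      _ ≤ ∑ y, C * E * Real.exp (-(c / 2) * d x₁ y) * (2 * v * (C * K)) := by
          refine Finset.sum_le_sum fun y _ => ?_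
          by_cases hy : Core y
          · have h0 : ∑ x₂, ‖((Vα - Vj) * G'α) y x₂‖ = 0 := by
              refine Finset.sum_eq_zero fun x₂ _ => ?_
              rw [norm_eq_zero, Matrix.mul_apply]
              exact Finset.sum_eq_zero fun z _ => by rw [Matrix.sub_apply, hVloc y z hy, sub_self, zero_mul]
            rw [h0, mul_zero]
            positivity
          · have hfar : R₂ ≤ d x₁ y := le_of_lt (lt_of_not_ge fun h => hy (hx₁ y h))
            have hGy : ‖Gref x₁ y‖ ≤ C * E * Real.exp (-(c / 2) * d x₁ y) := by
              calc ‖Gref x₁ y‖ ≤ C * Real.exp (-c * d x₁ y) := hGr x₁ y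
                _ ≤ C * (Real.exp (-(c / 2) * R₂) * Real.exp (-(c / 2) * d x₁ y)) := by
                    gcongr; exact exp_split_le hc hfar
                _ ≤ C * (E * Real.exp (-(c / 2) * d x₁ y)) := by gcongr; exact exp_mono_R hc hρ
                _ = _ := by ring
            have hrow : ∑ x₂, ‖((Vα - Vj) * G'α) y x₂‖ ≤ 2 * v * (C * K) := by
              have hz : ∑ z, ‖(Vα - Vj) y z‖ ≤ 2 * v := by
                calc ∑ z, ‖(Vα - Vj) y z‖ ≤ ∑ z, (‖Vα y z‖ + ‖Vj y z‖) :=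
                      Finset.sum_le_sum fun z _ => by rw [Matrix.sub_apply]; exact norm_sub_le _ _
                  _ ≤ 2 * v := by rw [Finset.sum_add_distrib]; linarith [hVα y, hVj y]
              exact (rowSum_mul_le _ _ _).trans
                (mul_le_mul hz (norm_le_of_decay hc hC hK₀ hd hK hG'α) (norm_nonneg _) (by positivity))
            exact mul_le_mul hGy hrow (by positivity) (by positivity)
      _ = C * E * (2 * v * (C * K)) * ∑ y, Real.exp (-(c / 2) * d x₁ y) := by
          rw [Finset.mul_sum]; refine Finset.sum_congr rfl fun y _ => ?_; ring
      _ ≤ C * E * (2 * v * (C * K)) * K := by gcongr; exact hK x₁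
      _ = _ := by ring
  -- (iii) `G′_α → G′_ref`: rows `z` in the core cost `δ`, rows outside are reached from `x₁` only over `> R₂ − ρ`
  have h3 : ∑ x₂, ‖(Gref * Vj * (G'α - Gref')) x₁ x₂‖
      ≤ v * (C * (δ * K) * K + C * E * (2 * (C * K)) * K) := by
    have hrowα : ∀ z, ∑ x₂, ‖G'α z x₂‖ ≤ C * K := rowSum_le_of_decay hc hd hK hG'α
    have hrowr : ∀ z, ∑ x₂, ‖Gref' z x₂‖ ≤ C * K := rowSum_le_of_decay hc hd hK hGr'
    calc ∑ x₂, ‖(Gref * Vj * (G'α - Gref')) x₁ x₂‖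
        ≤ ∑ z, ‖(Gref * Vj) x₁ z‖ * ∑ x₂, ‖(G'α - Gref') z x₂‖ := rowSum_mul_le' _ _ _
      _ ≤ ∑ z, ∑ y, ‖Gref x₁ y‖ * ‖Vj y z‖ * ∑ x₂, ‖(G'α - Gref') z x₂‖ := by
          refine Finset.sum_le_sum fun z _ => ?_
          rw [← Finset.sum_mul]
          refine mul_le_mul_of_nonneg_right ?_ (by positivity)
          rw [Matrix.mul_apply]
          exact (norm_sum_le _ _).trans (Finset.sum_le_sum fun y _ => norm_mul_le _ _)
      _ ≤ ∑ z, ∑ y, ‖Vj y z‖ * (C * (δ * K) * Real.exp (-c * d x₁ y)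
              + C * E * (2 * (C * K)) * Real.exp (-(c / 2) * d x₁ y)) := by
          refine Finset.sum_le_sum fun z _ => Finset.sum_le_sum fun y _ => ?_
          by_cases hV0 : Vj y z = 0
          · rw [hV0, norm_zero, mul_zero, zero_mul, zero_mul]
          have hyz : d y z ≤ ρ := hVρ y z hV0
          by_cases hz : Core z
          · have hrow : ∑ x₂, ‖(G'α - Gref') z x₂‖ ≤ δ * K := by
              calc ∑ x₂, ‖(G'α - Gref') z x₂‖ ≤ ∑ x₂, δ * Real.exp (-c * d z x₂) :=
                    Finset.sum_le_sum fun x₂ _ => by rw [Matrix.sub_apply]; exact hLG' z x₂ hz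
                _ = δ * ∑ x₂, Real.exp (-c * d z x₂) := by rw [Finset.mul_sum]
                _ ≤ δ * K := by gcongr; exact sum_exp_le hc hd hK z
            have hnn : 0 ≤ ‖Vj y z‖ * (C * E * (2 * (C * K)) * Real.exp (-(c / 2) * d x₁ y)) := by positivity
            calc ‖Gref x₁ y‖ * ‖Vj y z‖ * ∑ x₂, ‖(G'α - Gref') z x₂‖
                ≤ (C * Real.exp (-c * d x₁ y)) * ‖Vj y z‖ * (δ * K) := by gcongr; exact hGr x₁ y
              _ = ‖Vj y z‖ * (C * (δ * K) * Real.exp (-c * d x₁ y)) := by ring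
              _ ≤ _ := by rw [mul_add]; linarith
          · have hfarz : R₂ < d x₁ z := lt_of_not_ge fun h => hz (hx₁ z h)
            have hfary : R₂ - ρ ≤ d x₁ y := by linarith [htri x₁ y z]
            have hGy : ‖Gref x₁ y‖ ≤ C * (E * Real.exp (-(c / 2) * d x₁ y)) :=
              (hGr x₁ y).trans (by gcongr; exact exp_split_le hc hfary)
            have hrow : ∑ x₂, ‖(G'α - Gref') z x₂‖ ≤ 2 * (C * K) := by
              calc ∑ x₂, ‖(G'α - Gref') z x₂‖ ≤ ∑ x₂, (‖G'α z x₂‖ + ‖Gref' z x₂‖) :=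
                    Finset.sum_le_sum fun x₂ _ => by rw [Matrix.sub_apply]; exact norm_sub_le _ _
                _ ≤ 2 * (C * K) := by rw [Finset.sum_add_distrib]; linarith [hrowα z, hrowr z]
            have hnn : 0 ≤ ‖Vj y z‖ * (C * (δ * K) * Real.exp (-c * d x₁ y)) := by positivity
            calc ‖Gref x₁ y‖ * ‖Vj y z‖ * ∑ x₂, ‖(G'α - Gref') z x₂‖
                ≤ (C * (E * Real.exp (-(c / 2) * d x₁ y))) * ‖Vj y z‖ * (2 * (C * K)) := by gcongr
              _ = ‖Vj y z‖ * (C * E * (2 * (C * K)) * Real.exp (-(c / 2) * d x₁ y)) := by ring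
              _ ≤ _ := by rw [mul_add]; linarith
      _ = ∑ y, (∑ z, ‖Vj y z‖) * (C * (δ * K) * Real.exp (-c * d x₁ y)
              + C * E * (2 * (C * K)) * Real.exp (-(c / 2) * d x₁ y)) := by
          rw [Finset.sum_comm]
          simp_rw [Finset.sum_mul]
      _ ≤ ∑ y, v * (C * (δ * K) * Real.exp (-c * d x₁ y) + C * E * (2 * (C * K)) * Real.exp (-(c / 2) * d x₁ y)) :=
          Finset.sum_le_sum fun y _ => mul_le_mul_of_nonneg_right (hVj y) (by positivity)
      _ = v * (C * (δ * K) * ∑ y, Real.exp (-c * d x₁ y) + C * E * (2 * (C * K)) * ∑ y, Real.exp (-(c / 2) * d x₁ y)) := by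
          rw [← Finset.mul_sum, Finset.sum_add_distrib, Finset.mul_sum, Finset.mul_sum]
      _ ≤ v * (C * (δ * K) * K + C * E * (2 * (C * K)) * K) := by
          gcongr
          · exact sum_exp_le hc hd hK x₁
          · exact hK x₁
  -- assembling
  calc ∑ x₂, ‖(Gα * Vα * G'α - Gref * Vj * Gref') x₁ x₂‖
      = ∑ x₂, ‖((Gα - Gref) * (Vα * G'α)) x₁ x₂ + (Gref * ((Vα - Vj) * G'α)) x₁ x₂
          + (Gref * Vj * (G'α - Gref')) x₁ x₂‖ := by
        simp_rw [hdec, Matrix.add_apply]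
    _ ≤ ∑ x₂, (‖((Gα - Gref) * (Vα * G'α)) x₁ x₂‖ + ‖(Gref * ((Vα - Vj) * G'α)) x₁ x₂‖
          + ‖(Gref * Vj * (G'α - Gref')) x₁ x₂‖) :=
        Finset.sum_le_sum fun x₂ _ => norm_add₃_le
    _ = ∑ x₂, ‖((Gα - Gref) * (Vα * G'α)) x₁ x₂‖ + ∑ x₂, ‖(Gref * ((Vα - Vj) * G'α)) x₁ x₂‖
          + ∑ x₂, ‖(Gref * Vj * (G'α - Gref')) x₁ x₂‖ := by
        rw [Finset.sum_add_distrib, Finset.sum_add_distrib]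
    _ ≤ δ * K * (v * (C * K)) + C * E * K * (2 * v * (C * K)) + v * (C * (δ * K) * K + C * E * (2 * (C * K)) * K) :=
        add_le_add (add_le_add h1 h2) h3
    _ = C * K ^ 2 * v * (2 * δ + 4 * C * E) := by ring

/-- kernel: `‖G_{loc}‖ ≤ Λ₀CK` row by row, for `G_{loc} = ζ″Σ_βλ_βG′_β` with decaying `G′_β` ((2.30) in kernel form) and local
multiplicity `Σ_β sup|ζ″λ_β| ≤ Λ₀`. [cite: BalabanImbrieJaffe1988, (2.30) p.263] -/
theorem rowSum_gLoc_le {d : σ → σ → ℝ} {c C K Λ₀ : ℝ} (hc : 0 ≤ c) (hC : 0 ≤ C) (hd : ∀ x y, 0 ≤ d x y)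
    (hK : ∀ x, ∑ y, Real.exp (-(c / 2) * d x y) ≤ K)
    {Z : σ → σ → ℂ} {Λ : ι → σ → σ → ℂ} {μ : ι → σ → ℝ} (hμ0 : ∀ α x, 0 ≤ μ α x)
    (hΛμ : ∀ α x y, ‖Z x y * Λ α x y‖ ≤ μ α x) (hμ : ∀ x, ∑ α, μ α x ≤ Λ₀)
    {G' : ι → Matrix σ σ ℂ} (hG' : ∀ α x y, ‖G' α x y‖ ≤ C * Real.exp (-c * d x y)) (x : σ) :
    ∑ y, ‖gLoc Z Λ G' x y‖ ≤ Λ₀ * (C * K) := by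
  calc ∑ y, ‖gLoc Z Λ G' x y‖ = ∑ y, ‖∑ α, (Z x y * Λ α x y) * G' α x y‖ := by
        refine Finset.sum_congr rfl fun y _ => ?_
        rw [gLoc_apply, Finset.mul_sum]
        simp_rw [mul_assoc]
    _ ≤ ∑ y, ∑ α, μ α x * (C * Real.exp (-c * d x y)) :=
        Finset.sum_le_sum fun y _ => (norm_sum_le _ _).trans (Finset.sum_le_sum fun α _ => by
          rw [norm_mul]; exact mul_le_mul (hΛμ α x y) (hG' α x y) (norm_nonneg _) (hμ0 α x))
    _ = (∑ α, μ α x) * (C * ∑ y, Real.exp (-c * d x y)) := by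
        rw [Finset.sum_comm, Finset.sum_mul]
        refine Finset.sum_congr rfl fun α _ => ?_
        rw [Finset.mul_sum, Finset.mul_sum]
    _ ≤ Λ₀ * (C * K) := by
        have h1 : C * ∑ y, Real.exp (-c * d x y) ≤ C * K := by gcongr; exact sum_exp_le hc hd hK x
        have h2 : 0 ≤ C * ∑ y, Real.exp (-c * d x y) := by positivity
        calc (∑ α, μ α x) * (C * ∑ y, Real.exp (-c * d x y)) ≤ Λ₀ * (C * ∑ y, Real.exp (-c * d x y)) :=
              mul_le_mul_of_nonneg_right (hμ x) h2
          _ ≤ Λ₀ * (C * K) := mul_le_mul_of_nonneg_left h1 ((Finset.sum_nonneg fun α _ => hμ0 α x).trans (hμ x))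

/-- **changing the set inside `G_{loc}`**: since `Σ_αλ_α = 1` exactly ((2.27)), `G_{loc} − ζ″G_ref = ζ″Σ_αλ_α(G_α − G_ref)`, and
where `ζ″λ_α(x,·) ≠ 0` the point `x` is in the core of `□_α`, so (2.31) gives rows `≤ Λ₀δK`. [cite: BalabanImbrieJaffe1988, (2.31) p.263] -/
theorem rowSum_gLoc_sub_le {d : σ → σ → ℝ} {Core : ι → σ → Prop} {c δ K Λ₀ R₂ : ℝ} (hc : 0 ≤ c) (hδ : 0 ≤ δ)
    (hR₂ : 0 ≤ R₂) (hd : ∀ x y, 0 ≤ d x y) (hdd : ∀ x, d x x = 0)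
    (hK : ∀ x, ∑ y, Real.exp (-(c / 2) * d x y) ≤ K)
    {Z : σ → σ → ℂ} {Λ : ι → σ → σ → ℂ} {μ : ι → σ → ℝ} (hμ0 : ∀ α x, 0 ≤ μ α x)
    (hΛμ : ∀ α x y, ‖Z x y * Λ α x y‖ ≤ μ α x) (hμ : ∀ x, ∑ α, μ α x ≤ Λ₀) (hΛ1 : ∀ x y, ∑ α, Λ α x y = 1)
    (hcore : ∀ α x y, Z x y * Λ α x y ≠ 0 → ∀ z, d x z ≤ R₂ → Core α z)
    {G : ι → Matrix σ σ ℂ} {Gref : Matrix σ σ ℂ}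
    (hLG : ∀ α z y, Core α z → ‖G α z y - Gref z y‖ ≤ δ * Real.exp (-c * d z y)) (x : σ) :
    ∑ y, ‖gLoc Z Λ G x y - Z x y * Gref x y‖ ≤ Λ₀ * (δ * K) := by
  have hentry : ∀ y, gLoc Z Λ G x y - Z x y * Gref x y = ∑ α, (Z x y * Λ α x y) * (G α x y - Gref x y) := by
    intro y
    have h1 : Z x y * Gref x y = ∑ α, Z x y * Λ α x y * Gref x y := by
      rw [← Finset.sum_mul, ← Finset.mul_sum, hΛ1 x y, mul_one]
    rw [gLoc_apply, Finset.mul_sum, h1, ← Finset.sum_sub_distrib]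
    refine Finset.sum_congr rfl fun α _ => ?_
    ring
  have hterm : ∀ y α, ‖(Z x y * Λ α x y) * (G α x y - Gref x y)‖ ≤ μ α x * (δ * Real.exp (-c * d x y)) := by
    intro y α
    by_cases h0 : Z x y * Λ α x y = 0
    · rw [h0, zero_mul, norm_zero]
      exact mul_nonneg (hμ0 α x) (by positivity)
    · have hCx : Core α x := hcore α x y h0 x (by rw [hdd]; exact hR₂)
      rw [norm_mul]
      exact mul_le_mul (hΛμ α x y) (hLG α x y hCx) (norm_nonneg _) (hμ0 α x)
  calc ∑ y, ‖gLoc Z Λ G x y - Z x y * Gref x y‖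
      = ∑ y, ‖∑ α, (Z x y * Λ α x y) * (G α x y - Gref x y)‖ := by simp_rw [hentry]
    _ ≤ ∑ y, ∑ α, μ α x * (δ * Real.exp (-c * d x y)) :=
        Finset.sum_le_sum fun y _ => (norm_sum_le _ _).trans (Finset.sum_le_sum fun α _ => hterm y α)
    _ = (∑ α, μ α x) * (δ * ∑ y, Real.exp (-c * d x y)) := by
        rw [Finset.sum_comm, Finset.sum_mul]
        refine Finset.sum_congr rfl fun α _ => ?_
        rw [Finset.mul_sum, Finset.mul_sum]
    _ ≤ Λ₀ * (δ * K) := by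
        have h1 : δ * ∑ y, Real.exp (-c * d x y) ≤ δ * K := by gcongr; exact sum_exp_le hc hd hK x
        have h2 : 0 ≤ δ * ∑ y, Real.exp (-c * d x y) := by positivity
        calc (∑ α, μ α x) * (δ * ∑ y, Real.exp (-c * d x y)) ≤ Λ₀ * (δ * ∑ y, Real.exp (-c * d x y)) :=
              mul_le_mul_of_nonneg_right (hμ x) h2
          _ ≤ Λ₀ * (δ * K) := mul_le_mul_of_nonneg_left h1 ((Finset.sum_nonneg fun α _ => hμ0 α x).trans (hμ x))

/-- **changing the set in the second term**: with `Σ_αλ_α = 1`, `T − ζ″(G_refV_jG′_ref) = ζ″Σ_αλ_α(G_αV_αG′_α − G_refV_jG′_ref)`,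
and for each `α` with `ζ″λ_α(x₁,·) ≠ 0` the row estimate `rowSum_changeSet_le` applies (the `R₂`-neighbourhood of `x₁` is in the
core of `□_α`); the local multiplicity `Σ_α sup|ζ″λ_α| ≤ Λ₀` sums them: rows `≤ Λ₀·CK²v(2δ + 4Ce^{−(c/2)(R₂−ρ)})`.
[cite: BalabanImbrieJaffe1988, (5.6.12) p.287] -/
theorem rowSum_changeSet_sum_le {d : σ → σ → ℝ} {Core : ι → σ → Prop} {c C δ K v Λ₀ R₂ ρ : ℝ}
    (hc : 0 ≤ c) (hC : 0 ≤ C) (hδ : 0 ≤ δ) (hv : 0 ≤ v) (hρ : 0 ≤ ρ) (hR₂ : 0 ≤ R₂)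
    (hd : ∀ x y, 0 ≤ d x y) (hdd : ∀ x, d x x = 0) (htri : ∀ x y z, d x z ≤ d x y + d y z)
    (hK : ∀ x, ∑ y, Real.exp (-(c / 2) * d x y) ≤ K)
    {Z : σ → σ → ℂ} {Λ : ι → σ → σ → ℂ} {μ : ι → σ → ℝ} (hμ0 : ∀ α x, 0 ≤ μ α x)
    (hΛμ : ∀ α x y, ‖Z x y * Λ α x y‖ ≤ μ α x) (hμ : ∀ x, ∑ α, μ α x ≤ Λ₀) (hΛ1 : ∀ x y, ∑ α, Λ α x y = 1)
    (hcore : ∀ α x y, Z x y * Λ α x y ≠ 0 → ∀ z, d x z ≤ R₂ → Core α z)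
    {G V G' : ι → Matrix σ σ ℂ} {Gref Vj Gref' : Matrix σ σ ℂ}
    (hG' : ∀ α x y, ‖G' α x y‖ ≤ C * Real.exp (-c * d x y)) (hGr : ∀ x y, ‖Gref x y‖ ≤ C * Real.exp (-c * d x y))
    (hGr' : ∀ x y, ‖Gref' x y‖ ≤ C * Real.exp (-c * d x y))
    (hLG : ∀ α z y, Core α z → ‖G α z y - Gref z y‖ ≤ δ * Real.exp (-c * d z y))
    (hLG' : ∀ α z y, Core α z → ‖G' α z y - Gref' z y‖ ≤ δ * Real.exp (-c * d z y))
    (hVα : ∀ α y, ∑ z, ‖V α y z‖ ≤ v) (hVj : ∀ y, ∑ z, ‖Vj y z‖ ≤ v) (hVρ : ∀ y z, Vj y z ≠ 0 → d y z ≤ ρ)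
    (hVloc : ∀ α y z, Core α y → V α y z = Vj y z) (x₁ : σ) :
    ∑ x₂, ‖Z x₁ x₂ * ∑ α, Λ α x₁ x₂ * (G α * V α * G' α) x₁ x₂ - Z x₁ x₂ * (Gref * Vj * Gref') x₁ x₂‖
      ≤ Λ₀ * (C * K ^ 2 * v * (2 * δ + 4 * C * Real.exp (-(c / 2) * (R₂ - ρ)))) := by
  set B := C * K ^ 2 * v * (2 * δ + 4 * C * Real.exp (-(c / 2) * (R₂ - ρ))) with hB
  have hK₀ : 0 ≤ K := (Finset.sum_nonneg fun y _ => (Real.exp_pos _).le).trans (hK x₁)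
  have hB₀ : 0 ≤ B := by positivity
  have hentry : ∀ x₂, Z x₁ x₂ * ∑ α, Λ α x₁ x₂ * (G α * V α * G' α) x₁ x₂ - Z x₁ x₂ * (Gref * Vj * Gref') x₁ x₂
      = ∑ α, (Z x₁ x₂ * Λ α x₁ x₂) * (G α * V α * G' α - Gref * Vj * Gref') x₁ x₂ := by
    intro x₂
    have h1 : Z x₁ x₂ * (Gref * Vj * Gref') x₁ x₂ = ∑ α, Z x₁ x₂ * Λ α x₁ x₂ * (Gref * Vj * Gref') x₁ x₂ := by
      rw [← Finset.sum_mul, ← Finset.mul_sum, hΛ1 x₁ x₂, mul_one]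
    rw [Finset.mul_sum, h1, ← Finset.sum_sub_distrib]
    refine Finset.sum_congr rfl fun α _ => ?_
    rw [Matrix.sub_apply]
    ring
  -- per cube
  have hα : ∀ α, ∑ x₂, ‖(Z x₁ x₂ * Λ α x₁ x₂) * (G α * V α * G' α - Gref * Vj * Gref') x₁ x₂‖ ≤ μ α x₁ * B := by
    intro α
    by_cases hex : ∃ x₂, Z x₁ x₂ * Λ α x₁ x₂ ≠ 0
    · obtain ⟨x₂', hx₂'⟩ := hex
      have hx₁ : ∀ z, d x₁ z ≤ R₂ → Core α z := hcore α x₁ x₂' hx₂'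
      have hrow := rowSum_changeSet_le hc hC hδ hv hρ hR₂ hd hdd htri hK (hG' α) hGr hGr' (hLG α) (hLG' α) (hVα α)
        hVj hVρ (hVloc α) hx₁
      calc ∑ x₂, ‖(Z x₁ x₂ * Λ α x₁ x₂) * (G α * V α * G' α - Gref * Vj * Gref') x₁ x₂‖
          ≤ ∑ x₂, μ α x₁ * ‖(G α * V α * G' α - Gref * Vj * Gref') x₁ x₂‖ :=
            Finset.sum_le_sum fun x₂ _ => by
              rw [norm_mul]; exact mul_le_mul_of_nonneg_right (hΛμ α x₁ x₂) (norm_nonneg _)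
        _ = μ α x₁ * ∑ x₂, ‖(G α * V α * G' α - Gref * Vj * Gref') x₁ x₂‖ := by rw [Finset.mul_sum]
        _ ≤ μ α x₁ * B := mul_le_mul_of_nonneg_left hrow (hμ0 α x₁)
    · push Not at hex
      calc ∑ x₂, ‖(Z x₁ x₂ * Λ α x₁ x₂) * (G α * V α * G' α - Gref * Vj * Gref') x₁ x₂‖ = 0 :=
            Finset.sum_eq_zero fun x₂ _ => by rw [hex x₂, zero_mul, norm_zero]
        _ ≤ μ α x₁ * B := mul_nonneg (hμ0 α x₁) hB₀
  calc ∑ x₂, ‖Z x₁ x₂ * ∑ α, Λ α x₁ x₂ * (G α * V α * G' α) x₁ x₂ - Z x₁ x₂ * (Gref * Vj * Gref') x₁ x₂‖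
      = ∑ x₂, ‖∑ α, (Z x₁ x₂ * Λ α x₁ x₂) * (G α * V α * G' α - Gref * Vj * Gref') x₁ x₂‖ := by simp_rw [hentry]
    _ ≤ ∑ x₂, ∑ α, ‖(Z x₁ x₂ * Λ α x₁ x₂) * (G α * V α * G' α - Gref * Vj * Gref') x₁ x₂‖ :=
        Finset.sum_le_sum fun x₂ _ => norm_sum_le _ _
    _ = ∑ α, ∑ x₂, ‖(Z x₁ x₂ * Λ α x₁ x₂) * (G α * V α * G' α - Gref * Vj * Gref') x₁ x₂‖ := Finset.sum_comm
    _ ≤ ∑ α, μ α x₁ * B := Finset.sum_le_sum fun α _ => hα α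
    _ = (∑ α, μ α x₁) * B := by rw [Finset.sum_mul]
    _ ≤ Λ₀ * B := mul_le_mul_of_nonneg_right (hμ x₁) hB₀

end ChangeSet

/-! ## §4 The size of `w′₆`: *"small (O(e^{−cr(e_j)}))"* -/

section Main

variable {σ ι : Type*} [Fintype σ] [Fintype ι]

/-- kernel: the telescoping behind *"changing the set … and changing the tails"*: `T − G_{loc}V_jG′_{loc} = (T − T₃) + (T₃ − (ζ″G_ref)V_j
(ζ″G′_ref)) + (ζ″G_ref)V_j(ζ″G′_ref − G′_{loc}) + (ζ″G_ref − G_{loc})V_jG′_{loc}`. [folklore] -/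
private theorem split4 (T T3 ZG ZG' Vj gL gL' : Matrix σ σ ℂ) :
    T - gL * Vj * gL' = (T - T3) + (T3 - ZG * Vj * ZG') + ZG * Vj * (ZG' - gL') + (ZG - gL) * Vj * gL' := by
  simp only [Matrix.mul_sub, Matrix.sub_mul]
  abel

/-- **`w′₆` is small** — p. 287, *"The difference is w′₆, a small (O(e^{−cr(e_j)})) … kernel"*, PROVED for `w′₆ = BIJ88Eq5612W6.w6prime
ζ″ λ G V G′ V_j` in the max-row-sum operator norm from: the decay (2.30) in kernel form `‖G′_α(x,y)‖, ‖G_ref(x,y)‖, ‖G′_ref(x,y)‖ ≤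
Ce^{−c d(x,y)}`; the localization (2.31) in kernel form inside the core of `□_α`, `‖G_α(z,·) − G_ref(z,·)‖, ‖G′_α(z,·) − G′_ref(z,·)‖
≤ δe^{−c d(z,·)}` for `Core α z` (`δ = e^{−cr(e_j)}` in print; `G_ref` e.g. `G_{j,loc}` itself with `Ω = □_α`, see
`norm_w6prime_le_of231`); the cutoff (2.29) `|ζ″| ≤ 1`, `ζ″ = 1` within `R₁`; the convex combination (2.27) `Σ_αλ_α = 1` with local
multiplicity `|ζ″λ_α(x,·)| ≤ μ_α(x)`, `Σ_αμ_α(x) ≤ Λ₀`, supported so that the `R₂`-neighbourhood of `x` lies in the core of `□_α`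
whenever `ζ″λ_α(x,·) ≠ 0`; `V_j` of range `ρ` with rows `≤ v` and `V_j(□_α)(y,·) = V_j(y,·)` in the core (§5); `Σ_ye^{−(c/2)d(x,y)} ≤
K`.  Then `‖w′₆‖ ≤ CK²v·[Λ₀(Λ₀+3)δ + 4Λ₀Ce^{−(c/2)(R₂−ρ)} + 2Ce^{−(c/2)(R₁−ρ)}]`. [cite: BalabanImbrieJaffe1988, (5.6.12) p.287] -/
theorem norm_w6prime_le {d : σ → σ → ℝ} {Core : ι → σ → Prop} {c C δ K v Λ₀ R₁ R₂ ρ : ℝ}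
    (hc : 0 ≤ c) (hC : 0 ≤ C) (hδ : 0 ≤ δ) (hK₀ : 0 ≤ K) (hv : 0 ≤ v) (hΛ₀ : 0 ≤ Λ₀) (hρ : 0 ≤ ρ) (hR₂ : 0 ≤ R₂)
    (hd : ∀ x y, 0 ≤ d x y) (hdd : ∀ x, d x x = 0) (htri : ∀ x y z, d x z ≤ d x y + d y z)
    (hK : ∀ x, ∑ y, Real.exp (-(c / 2) * d x y) ≤ K)
    {Z : σ → σ → ℂ} (hZ1 : ∀ x y, ‖Z x y‖ ≤ 1) (hZR₁ : ∀ x y, d x y ≤ R₁ → Z x y = 1)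
    {Λ : ι → σ → σ → ℂ} {μ : ι → σ → ℝ} (hμ0 : ∀ α x, 0 ≤ μ α x)
    (hΛμ : ∀ α x y, ‖Z x y * Λ α x y‖ ≤ μ α x) (hμ : ∀ x, ∑ α, μ α x ≤ Λ₀) (hΛ1 : ∀ x y, ∑ α, Λ α x y = 1)
    (hcore : ∀ α x y, Z x y * Λ α x y ≠ 0 → ∀ z, d x z ≤ R₂ → Core α z)
    {G V G' : ι → Matrix σ σ ℂ} {Gref Vj Gref' : Matrix σ σ ℂ}
    (hG' : ∀ α x y, ‖G' α x y‖ ≤ C * Real.exp (-c * d x y)) (hGr : ∀ x y, ‖Gref x y‖ ≤ C * Real.exp (-c * d x y))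
    (hGr' : ∀ x y, ‖Gref' x y‖ ≤ C * Real.exp (-c * d x y))
    (hLG : ∀ α z y, Core α z → ‖G α z y - Gref z y‖ ≤ δ * Real.exp (-c * d z y))
    (hLG' : ∀ α z y, Core α z → ‖G' α z y - Gref' z y‖ ≤ δ * Real.exp (-c * d z y))
    (hVα : ∀ α y, ∑ z, ‖V α y z‖ ≤ v) (hVj : ∀ y, ∑ z, ‖Vj y z‖ ≤ v) (hVρ : ∀ y z, Vj y z ≠ 0 → d y z ≤ ρ)
    (hVloc : ∀ α y z, Core α y → V α y z = Vj y z) :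
    ‖w6prime Z Λ G V G' Vj‖ ≤ C * K ^ 2 * v * (Λ₀ * (Λ₀ + 3) * δ + 4 * Λ₀ * C * Real.exp (-(c / 2) * (R₂ - ρ))
        + 2 * C * Real.exp (-(c / 2) * (R₁ - ρ))) := by
  set T : Matrix σ σ ℂ := Matrix.of fun x₁ x₂ => Z x₁ x₂ * ∑ α, Λ α x₁ x₂ * (G α * V α * G' α) x₁ x₂ with hT
  set T3 : Matrix σ σ ℂ := Matrix.of fun x₁ x₂ => Z x₁ x₂ * (Gref * Vj * Gref') x₁ x₂ with hT3
  set ZG : Matrix σ σ ℂ := Matrix.of fun x y => Z x y * Gref x y with hZG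
  set ZG' : Matrix σ σ ℂ := Matrix.of fun x y => Z x y * Gref' x y with hZG'
  have hw : w6prime Z Λ G V G' Vj = T - gLoc Z Λ G * Vj * gLoc Z Λ G' := rfl
  -- the four pieces
  have hP1 : ‖T - T3‖ ≤ Λ₀ * (C * K ^ 2 * v * (2 * δ + 4 * C * Real.exp (-(c / 2) * (R₂ - ρ)))) := by
    refine norm_le_of_rowSums _ (by positivity) fun x₁ => ?_
    simp only [hT, hT3, Matrix.sub_apply, Matrix.of_apply]
    exact rowSum_changeSet_sum_le hc hC hδ hv hρ hR₂ hd hdd htri hK hμ0 hΛμ hμ hΛ1 hcore hG' hGr hGr' hLG hLG' hVα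
      hVj hVρ hVloc x₁
  have hP2 : ‖T3 - ZG * Vj * ZG'‖ ≤ 2 * C ^ 2 * K ^ 2 * v * Real.exp (-(c / 2) * (R₁ - ρ)) := by
    refine norm_le_of_rowSums _ (by positivity) fun x₁ => ?_
    simp only [hT3, hZG, hZG', Matrix.sub_apply, Matrix.of_apply]
    exact rowSum_tails_le hc hC hv hρ hd htri hK hZ1 hZR₁ hGr hGr' hVj hVρ x₁
  have hZGn : ‖ZG‖ ≤ C * K := by
    refine norm_le_of_decay hc hC hK₀ hd hK fun x y => ?_
    rw [hZG, Matrix.of_apply, norm_mul]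
    calc ‖Z x y‖ * ‖Gref x y‖ ≤ 1 * (C * Real.exp (-c * d x y)) :=
        mul_le_mul (hZ1 x y) (hGr x y) (norm_nonneg _) zero_le_one
      _ = _ := one_mul _
  have hVjn : ‖Vj‖ ≤ v := norm_le_of_rowSums _ hv hVj
  have hgL' : ‖gLoc Z Λ G'‖ ≤ Λ₀ * (C * K) :=
    norm_le_of_rowSums _ (by positivity) (rowSum_gLoc_le hc hC hd hK hμ0 hΛμ hμ hG')
  have hdG : ‖ZG - gLoc Z Λ G‖ ≤ Λ₀ * (δ * K) := by
    rw [norm_sub_rev]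
    refine norm_le_of_rowSums _ (by positivity) fun x => ?_
    simp only [hZG, Matrix.sub_apply, Matrix.of_apply]
    exact rowSum_gLoc_sub_le hc hδ hR₂ hd hdd hK hμ0 hΛμ hμ hΛ1 hcore hLG x
  have hdG' : ‖ZG' - gLoc Z Λ G'‖ ≤ Λ₀ * (δ * K) := by
    rw [norm_sub_rev]
    refine norm_le_of_rowSums _ (by positivity) fun x => ?_
    simp only [hZG', Matrix.sub_apply, Matrix.of_apply]
    exact rowSum_gLoc_sub_le hc hδ hR₂ hd hdd hK hμ0 hΛμ hμ hΛ1 hcore hLG' x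
  have hP3 : ‖ZG * Vj * (ZG' - gLoc Z Λ G')‖ ≤ C * K * v * (Λ₀ * (δ * K)) :=
    calc ‖ZG * Vj * (ZG' - gLoc Z Λ G')‖ ≤ ‖ZG‖ * ‖Vj‖ * ‖ZG' - gLoc Z Λ G'‖ :=
          (norm_mul_le _ _).trans (mul_le_mul_of_nonneg_right (norm_mul_le _ _) (norm_nonneg _))
      _ ≤ C * K * v * (Λ₀ * (δ * K)) := by gcongr
  have hP4 : ‖(ZG - gLoc Z Λ G) * Vj * gLoc Z Λ G'‖ ≤ Λ₀ * (δ * K) * v * (Λ₀ * (C * K)) :=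
    calc ‖(ZG - gLoc Z Λ G) * Vj * gLoc Z Λ G'‖ ≤ ‖ZG - gLoc Z Λ G‖ * ‖Vj‖ * ‖gLoc Z Λ G'‖ :=
          (norm_mul_le _ _).trans (mul_le_mul_of_nonneg_right (norm_mul_le _ _) (norm_nonneg _))
      _ ≤ Λ₀ * (δ * K) * v * (Λ₀ * (C * K)) := by gcongr
  calc ‖w6prime Z Λ G V G' Vj‖
      = ‖(T - T3) + (T3 - ZG * Vj * ZG') + ZG * Vj * (ZG' - gLoc Z Λ G') + (ZG - gLoc Z Λ G) * Vj * gLoc Z Λ G'‖ := by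
        rw [hw, split4 T T3 ZG ZG']
    _ ≤ ‖T - T3‖ + ‖T3 - ZG * Vj * ZG'‖ + ‖ZG * Vj * (ZG' - gLoc Z Λ G')‖ + ‖(ZG - gLoc Z Λ G) * Vj * gLoc Z Λ G'‖ :=
        (norm_add_le _ _).trans (add_le_add norm_add₃_le le_rfl)
    _ ≤ Λ₀ * (C * K ^ 2 * v * (2 * δ + 4 * C * Real.exp (-(c / 2) * (R₂ - ρ))))
          + 2 * C ^ 2 * K ^ 2 * v * Real.exp (-(c / 2) * (R₁ - ρ)) + C * K * v * (Λ₀ * (δ * K))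
          + Λ₀ * (δ * K) * v * (Λ₀ * (C * K)) :=
        add_le_add (add_le_add (add_le_add hP1 hP2) hP3) hP4
    _ = _ := by ring

omit [Fintype σ] in
/-- kernel: `G_{loc} = ζ″Σ_αλ_αG_α` inherits the decay of the `G_α` when `|ζ″| ≤ 1` and `Σ_α|λ_α| ≤ 1` (a convex combination) — the
mechanism of (2.30) for `G_{k,loc}` from the Neumann propagators. [cite: BalabanImbrieJaffe1988, (2.30) p.263] -/
theorem norm_gLoc_apply_le {d : σ → σ → ℝ} {c C : ℝ} (hC : 0 ≤ C) {Z : σ → σ → ℂ} (hZ1 : ∀ x y, ‖Z x y‖ ≤ 1)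
    {Λ : ι → σ → σ → ℂ} (hΛabs : ∀ x y, ∑ α, ‖Λ α x y‖ ≤ 1) {G : ι → Matrix σ σ ℂ}
    (hG : ∀ α x y, ‖G α x y‖ ≤ C * Real.exp (-c * d x y)) (x y : σ) :
    ‖gLoc Z Λ G x y‖ ≤ C * Real.exp (-c * d x y) := by
  have hC : 0 ≤ C * Real.exp (-c * d x y) := by positivity
  rw [gLoc_apply, norm_mul]
  calc ‖Z x y‖ * ‖∑ α, Λ α x y * G α x y‖ ≤ 1 * ∑ α, ‖Λ α x y‖ * (C * Real.exp (-c * d x y)) :=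
        mul_le_mul (hZ1 x y) ((norm_sum_le _ _).trans (Finset.sum_le_sum fun α _ => by
          rw [norm_mul]; exact mul_le_mul_of_nonneg_left (hG α x y) (norm_nonneg _))) (norm_nonneg _) zero_le_one
    _ = (∑ α, ‖Λ α x y‖) * (C * Real.exp (-c * d x y)) := by rw [one_mul, Finset.sum_mul]
    _ ≤ 1 * (C * Real.exp (-c * d x y)) := mul_le_mul_of_nonneg_right (hΛabs x y) hC
    _ = _ := one_mul _

/-- **`w′₆` is small, with `G_ref = G_{j,loc}` — the inputs exactly as printed**: (2.30) `|G_j(□_α,u)(x,y)| ≤ Ce^{−c d(x,y)}` for the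
Neumann propagators at both fields `u = ũ_{k+1}`, `ũ_{k+1}ũ`; (2.31) with `Ω = □_α`, *"|(G_{k,loc}(u)f − G_k(Ω,u)f)(x)| ≦ e^{−cr(e_k)}
e^{−c dist(suppt f,x)}‖f‖_∞ for dist(x,Ω^c) ≧ O(r(e_k))"* at `f = δ_y`: `‖G_{j,loc}(z,y) − G_j(□_α)(z,y)‖ ≤ δe^{−c d(z,y)}` for `z` in
the core of `□_α`; (2.27) `λ_α ≥ 0`-type weights with `Σ_αλ_α = 1`, `Σ_α|λ_α| ≤ 1`; (2.29); and the `V_j` data.  Then `‖w′₆‖ ≤ CK²v·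
[Λ₀(Λ₀+3)δ + 4Λ₀Ce^{−(c/2)(R₂−ρ)} + 2Ce^{−(c/2)(R₁−ρ)}]`. [cite: BalabanImbrieJaffe1988, (2.31) p.263] -/
theorem norm_w6prime_le_of231 {d : σ → σ → ℝ} {Core : ι → σ → Prop} {c C δ K v Λ₀ R₁ R₂ ρ : ℝ}
    (hc : 0 ≤ c) (hC : 0 ≤ C) (hδ : 0 ≤ δ) (hK₀ : 0 ≤ K) (hv : 0 ≤ v) (hΛ₀ : 0 ≤ Λ₀) (hρ : 0 ≤ ρ) (hR₂ : 0 ≤ R₂)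
    (hd : ∀ x y, 0 ≤ d x y) (hdd : ∀ x, d x x = 0) (htri : ∀ x y z, d x z ≤ d x y + d y z)
    (hK : ∀ x, ∑ y, Real.exp (-(c / 2) * d x y) ≤ K)
    {Z : σ → σ → ℂ} (hZ1 : ∀ x y, ‖Z x y‖ ≤ 1) (hZR₁ : ∀ x y, d x y ≤ R₁ → Z x y = 1)
    {Λ : ι → σ → σ → ℂ} {μ : ι → σ → ℝ} (hμ0 : ∀ α x, 0 ≤ μ α x)
    (hΛμ : ∀ α x y, ‖Z x y * Λ α x y‖ ≤ μ α x) (hμ : ∀ x, ∑ α, μ α x ≤ Λ₀) (hΛ1 : ∀ x y, ∑ α, Λ α x y = 1)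
    (hΛabs : ∀ x y, ∑ α, ‖Λ α x y‖ ≤ 1)
    (hcore : ∀ α x y, Z x y * Λ α x y ≠ 0 → ∀ z, d x z ≤ R₂ → Core α z)
    {G V G' : ι → Matrix σ σ ℂ} {Vj : Matrix σ σ ℂ}
    (hG : ∀ α x y, ‖G α x y‖ ≤ C * Real.exp (-c * d x y)) (hG' : ∀ α x y, ‖G' α x y‖ ≤ C * Real.exp (-c * d x y))
    (h231 : ∀ α z y, Core α z → ‖gLoc Z Λ G z y - G α z y‖ ≤ δ * Real.exp (-c * d z y))
    (h231' : ∀ α z y, Core α z → ‖gLoc Z Λ G' z y - G' α z y‖ ≤ δ * Real.exp (-c * d z y))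
    (hVα : ∀ α y, ∑ z, ‖V α y z‖ ≤ v) (hVj : ∀ y, ∑ z, ‖Vj y z‖ ≤ v) (hVρ : ∀ y z, Vj y z ≠ 0 → d y z ≤ ρ)
    (hVloc : ∀ α y z, Core α y → V α y z = Vj y z) :
    ‖w6prime Z Λ G V G' Vj‖ ≤ C * K ^ 2 * v * (Λ₀ * (Λ₀ + 3) * δ + 4 * Λ₀ * C * Real.exp (-(c / 2) * (R₂ - ρ))
        + 2 * C * Real.exp (-(c / 2) * (R₁ - ρ))) :=
  norm_w6prime_le hc hC hδ hK₀ hv hΛ₀ hρ hR₂ hd hdd htri hK hZ1 hZR₁ hμ0 hΛμ hμ hΛ1 hcore hG'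
    (norm_gLoc_apply_le hC hZ1 hΛabs hG) (norm_gLoc_apply_le hC hZ1 hΛabs hG')
    (fun α z y hz => by rw [norm_sub_rev]; exact h231 α z y hz) (fun α z y hz => by rw [norm_sub_rev]; exact h231' α z y hz)
    hVα hVj hVρ hVloc

/-- **the printed `O(e^{−cr(e_j)})`**: if the localization constant is `δ ≤ e^{−c₀r}` ((2.31): `e^{−cr(e_k)}`) and the two thresholds
satisfy `(c/2)(R₂ − ρ) ≥ c₀r`, `(c/2)(R₁ − ρ) ≥ c₀r` (the cores (2.27) and the cutoff (2.29) live on the scale `r(e_j)`, the range `ρ`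
of `V_j` is `O(1)`), the bound of `norm_w6prime_le` is `≤ CK²v(Λ₀(Λ₀+3) + 4Λ₀C + 2C)·e^{−c₀r}`. [cite: BalabanImbrieJaffe1988, (5.6.12) p.287] -/
theorem bound_le_exp {c C δ K v Λ₀ R₁ R₂ ρ c₀ r : ℝ} (hC : 0 ≤ C) (hv : 0 ≤ v) (hΛ₀ : 0 ≤ Λ₀)
    (hδ : δ ≤ Real.exp (-c₀ * r)) (h2 : c₀ * r ≤ (c / 2) * (R₂ - ρ)) (h1 : c₀ * r ≤ (c / 2) * (R₁ - ρ)) :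
    C * K ^ 2 * v * (Λ₀ * (Λ₀ + 3) * δ + 4 * Λ₀ * C * Real.exp (-(c / 2) * (R₂ - ρ)) + 2 * C * Real.exp (-(c / 2) * (R₁ - ρ)))
      ≤ C * K ^ 2 * v * (Λ₀ * (Λ₀ + 3) + 4 * Λ₀ * C + 2 * C) * Real.exp (-c₀ * r) := by
  have e2 : Real.exp (-(c / 2) * (R₂ - ρ)) ≤ Real.exp (-c₀ * r) := Real.exp_le_exp.mpr (by linarith)
  have e1 : Real.exp (-(c / 2) * (R₁ - ρ)) ≤ Real.exp (-c₀ * r) := Real.exp_le_exp.mpr (by linarith)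
  calc C * K ^ 2 * v * (Λ₀ * (Λ₀ + 3) * δ + 4 * Λ₀ * C * Real.exp (-(c / 2) * (R₂ - ρ))
        + 2 * C * Real.exp (-(c / 2) * (R₁ - ρ)))
      ≤ C * K ^ 2 * v * (Λ₀ * (Λ₀ + 3) * Real.exp (-c₀ * r) + 4 * Λ₀ * C * Real.exp (-c₀ * r)
        + 2 * C * Real.exp (-c₀ * r)) := by gcongr
    _ = _ := by ring

/-- **(5.6.12)'s `w₆` is small** — *"with another small kernel w₆"*: combining `BIJ88Eq5612W6.norm_w6_matrix_le` (`‖w₆‖ ≤ (Σ_{n≤n̄}θⁿ)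
‖w′₆‖` for `‖G_{loc}V_j‖ ≤ θ`) with `norm_w6prime_le`. [cite: BalabanImbrieJaffe1988, (5.6.12) p.288] -/
theorem norm_w6_le_printed [DecidableEq σ] {d : σ → σ → ℝ} {Core : ι → σ → Prop} {c C δ K v Λ₀ R₁ R₂ ρ θ : ℝ}
    (hc : 0 ≤ c) (hC : 0 ≤ C) (hδ : 0 ≤ δ) (hK₀ : 0 ≤ K) (hv : 0 ≤ v) (hΛ₀ : 0 ≤ Λ₀) (hρ : 0 ≤ ρ) (hR₂ : 0 ≤ R₂)
    (hd : ∀ x y, 0 ≤ d x y) (hdd : ∀ x, d x x = 0) (htri : ∀ x y z, d x z ≤ d x y + d y z)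
    (hK : ∀ x, ∑ y, Real.exp (-(c / 2) * d x y) ≤ K)
    {Z : σ → σ → ℂ} (hZ1 : ∀ x y, ‖Z x y‖ ≤ 1) (hZR₁ : ∀ x y, d x y ≤ R₁ → Z x y = 1)
    {Λ : ι → σ → σ → ℂ} {μ : ι → σ → ℝ} (hμ0 : ∀ α x, 0 ≤ μ α x)
    (hΛμ : ∀ α x y, ‖Z x y * Λ α x y‖ ≤ μ α x) (hμ : ∀ x, ∑ α, μ α x ≤ Λ₀) (hΛ1 : ∀ x y, ∑ α, Λ α x y = 1)
    (hcore : ∀ α x y, Z x y * Λ α x y ≠ 0 → ∀ z, d x z ≤ R₂ → Core α z)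
    {G V G' : ι → Matrix σ σ ℂ} {Gref Vj Gref' : Matrix σ σ ℂ}
    (hG' : ∀ α x y, ‖G' α x y‖ ≤ C * Real.exp (-c * d x y)) (hGr : ∀ x y, ‖Gref x y‖ ≤ C * Real.exp (-c * d x y))
    (hGr' : ∀ x y, ‖Gref' x y‖ ≤ C * Real.exp (-c * d x y))
    (hLG : ∀ α z y, Core α z → ‖G α z y - Gref z y‖ ≤ δ * Real.exp (-c * d z y))
    (hLG' : ∀ α z y, Core α z → ‖G' α z y - Gref' z y‖ ≤ δ * Real.exp (-c * d z y))
    (hVα : ∀ α y, ∑ z, ‖V α y z‖ ≤ v) (hVj : ∀ y, ∑ z, ‖Vj y z‖ ≤ v) (hVρ : ∀ y z, Vj y z ≠ 0 → d y z ≤ ρ)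
    (hVloc : ∀ α y z, Core α y → V α y z = Vj y z) (hθ : ‖gLoc Z Λ G * Vj‖ ≤ θ) (N : ℕ) :
    ‖w6 (gLoc Z Λ G) Vj (w6prime Z Λ G V G' Vj) N‖
      ≤ (∑ n ∈ Finset.range (N + 1), θ ^ n) * (C * K ^ 2 * v * (Λ₀ * (Λ₀ + 3) * δ
          + 4 * Λ₀ * C * Real.exp (-(c / 2) * (R₂ - ρ)) + 2 * C * Real.exp (-(c / 2) * (R₁ - ρ)))) := by
  have hθ0 : 0 ≤ θ := (norm_nonneg _).trans hθ
  exact (norm_w6_matrix_le hθ N).trans (mul_le_mul_of_nonneg_left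
    (norm_w6prime_le hc hC hδ hK₀ hv hΛ₀ hρ hR₂ hd hdd htri hK hZ1 hZR₁ hμ0 hΛμ hμ hΛ1 hcore hG' hGr hGr' hLG hLG' hVα hVj
      hVρ hVloc) (Finset.sum_nonneg fun n _ => pow_nonneg hθ0 n))

end Main

/-! ## §5 `V_j(□_α) = V_j` away from `∂□_α`: the `Ω`-dependence of the computed `V_j(Ω)` -/

section VjLocal

variable {P : Params} {j : ℕ} {τ : Type*} [Fintype τ]

/-- kernel: in `XᴴχY` with a diagonal bond weight `χ`, the row `y` sees only the weights of bonds `b` with `X(b,y) ≠ 0`. [folklore] -/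
private theorem sandwich_diagonal_apply_congr {β κ : Type*} [Fintype β] [DecidableEq β] (X Y : Matrix β κ ℂ)
    (d₁ d₂ : β → ℂ) {y : κ} (h : ∀ b, X b y ≠ 0 → d₁ b = d₂ b) (z : κ) :
    (Xᴴ * Matrix.diagonal d₁ * Y) y z = (Xᴴ * Matrix.diagonal d₂ * Y) y z := by
  rw [Matrix.mul_apply, Matrix.mul_apply]
  simp only [Matrix.mul_diagonal, Matrix.conjTranspose_apply]
  refine Finset.sum_congr rfl fun b _ => ?_
  by_cases hb : X b y = 0
  · simp [hb]
  · rw [h b hb]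

/-- **`V_j(Ω)` depends on `Ω`, in the row `y`, only through the bonds at `y`** — for the computed `V_j(Ω) = −(D_uᴴχ_ΩM + Mᴴχ_ΩD_u +
Mᴴχ_ΩM) − a_j(QᴴF₂ + F₂ᴴQ + F₂ᴴF₂)` of (5.6.10) (`BIJ88Vj5610Operator.vjMat`, Neumann cut-off `χ_Ω = chiN Ω`): if the bonds touching
`y` belong to `Ω` and `Ω′` alike, then `V_j(Ω)(y,·) = V_j(Ω′)(y,·)`.  This is the input *"changing the set □_α"* uses for `V_j`:
`V_j(□_α)(y,·) = V_j(y,·)` for `y` in the interior of `□_α` (hypothesis `hVloc` of §4). [cite: BalabanImbrieJaffe1988, (5.6.10) p.287] -/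
theorem vjMat_apply_congr (aj c : ℝ) (u a : PBond P j → ℂ) (B : τ → Finset (Balaban1983to89.Site P j)) (w : ℝ)
    (U A : τ → Balaban1983to89.Site P j → ℂ) {Ω Ω' : Finset (Balaban1983to89.Site P j)} {y : Balaban1983to89.Site P j}
    (h : ∀ b : PBond P j, y = b.tgt ∨ y = b.src → (b ∈ starB Ω ↔ b ∈ starB Ω')) (z : Balaban1983to89.Site P j) :
    vjMat aj c u a (chiN Ω) B w U A y z = vjMat aj c u a (chiN Ω') B w U A y z := by
  have hχ : ∀ b : PBond P j, (y = b.tgt ∨ y = b.src) →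
      (if b ∈ starB Ω then (1 : ℂ) else 0) = (if b ∈ starB Ω' then 1 else 0) := fun b hb => by
    rw [if_congr (h b hb) rfl rfl]
  have hD : ∀ b : PBond P j, dMat c u b y ≠ 0 → y = b.tgt ∨ y = b.src := by
    intro b hb
    by_contra hn
    push Not at hn
    apply hb
    simp [dMat, hn.1, hn.2]
  have hM : ∀ b : PBond P j, mMat c u a b y ≠ 0 → y = b.tgt ∨ y = b.src := by
    intro b hb
    by_contra hn
    push Not at hn
    apply hb
    simp [mMat, hn.1]
  simp only [vjMat, chiN, Matrix.sub_apply, Matrix.neg_apply, Matrix.add_apply, Matrix.smul_apply]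
  rw [sandwich_diagonal_apply_congr (dMat c u) (mMat c u a) _ _ (fun b hb => hχ b (hD b hb)) z,
    sandwich_diagonal_apply_congr (mMat c u a) (dMat c u) _ _ (fun b hb => hχ b (hM b hb)) z,
    sandwich_diagonal_apply_congr (mMat c u a) (mMat c u a) _ _ (fun b hb => hχ b (hM b hb)) z]

end VjLocal

end

end Literature.MathematicalPhysics.QuantumFieldTheory.BalabanImbrieJaffe1984to88.BIJ88W6PrimeSmall287
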